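import Literature.MathematicalPhysics.PowerSystems.LoadedRingNormalOperationCensus
import HarnessLib

/-!
# Bounds on the number of normal-operation synchronous states of a loaded ring from network data
# alone (Manik–Timme–Witthaut 2017, Cor. 3 / Cor. 4): `𝒩 ≤ 2⌊N/4⌋ + 1`, the lower bound
# `𝒩 ≥ ⌈(N/2π)(2K_min − P̄_max)/K_max⌉ − 1`, the multistability criterion
# `P̄_max < 2K_min − (4π/N)K_max ⇒ 𝒩 ≥ 2` — and a kernel COUNTEREXAMPLE to the printed upper bound
# `𝒩 ≤ ⌈(N/4)(2K_max − P̄_max)/K_min⌉`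

Topic `Literature/MathematicalPhysics/PowerSystems`, namespace
`Literature.MathematicalPhysics.PowerSystems.ClassicalModel`. Sequel of
`LoadedRingNormalOperationCensus.lean` (gridfusion-lit-1: Thm 12, `loadedRing_census`: the pinned
normal-operation synchronous states of a loaded ring number
`𝒩 = (⌈W(f_max)/2π⌉ − ⌊W(f_min)/2π⌋ − 1).toNat`, `W(f) = Σₖ arcsin((F⁰ₖ + f)/Kₖ)`). Everything
below is PROVED (no definition, no named fact, no new axiom).

SOURCE (read on the page this session). D. Manik, M. Timme, D. Witthaut, *Cycle flows and
multistability in oscillatory networks*, Chaos 27 (2017) 083123 [ManikTimmeWitthaut2017]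
(`lit read arxiv:1611.09825`, TeX source as held, chunks p0012 L120 – p0013 L140). **Def. 13**
(fragments, partial net power `P̄ᵢⱼ = Σ_{k=i}^{j} Pₖ`, `P̄_max = max_{i,j} P̄ᵢⱼ`,
`K_max = maxⱼ K_{j+1,j}`, `K_min = minⱼ K_{j+1,j}`); **Lemma 4** («the partial net power is equal to
the net outwards flow: P̄ᵢⱼ = F_{j+1,j} − F_{i−1,i} and P̄_max = maxⱼ F_{j+1,j} − minᵢ F_{i−1,i}»);
**Cor. 3** (p0013 L17–L30): «For a ring network R_N, the number of normal operation fixed points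
(denoted by 𝒩) is bounded from above and below by 0 ≤ 𝒩 ≤ 2⌊N/4⌋ + 1 and by
⌈(N/4)(2K_max − P̄_max)/K_min⌉ ≥ 𝒩 ≥ ⌈(N/2π)(2K_min − P̄_max)/K_max⌉ − 1», proof p0013 L32–L118
(«arcsin(x) ∈ [−π/2, +π/2] such that ϖ(f^max_c) < N/4, ϖ(f^min_c) > −N/4 … To proof the second
part, we start from ⌈ϖ(f^max_c) − ϖ(f^min_c)⌉ − 1 ≤ 𝒩 ≤ ⌈ϖ(f^max_c) − ϖ(f^min_c)⌉ … the
trigonometric relation x − y ≤ arcsin(x) − arcsin(y) ≤ (π/2)(x − y) which holds for all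
−1 ≤ y ≤ x ≤ 1 … Δf_c ≥ 2K_min − P̄_max … Δf_c ≤ 2K_max − P̄_max»); **Cor. 4** (p0013 L121–L135):
«ring networks R_N with N ≤ 4 do not have multiple stable fixed points. Ring network R_N with N ≥ 7
nodes will have multiple stable fixed points (𝒩 ≥ 2) if P̄_max < 2K_min − (4π/N)K_max».

CONVENTIONS: those of `LoadedRingNormalOperationCensus` (`S : LosslessSystem (n+1) 0` with ring
coupling `hC`, capacities `Kₖ > 0` on the edges `(k, ρk)`, reference flow `F⁰` with
`P̃ₖ = F⁰ₖ − F⁰_{ρ⁻¹k}`, pinned box representatives). By Lemma 4 the maximal partial net power is the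
spread of any flow solution, so `P̄_max` is typed as `maxₖ F⁰ₖ − minₖ F⁰ₖ` (`Finset.sup' − Finset.inf'`);
`K_max = maxₖ Kₖ`, `K_min = minₖ Kₖ`.

## What is proved

* §1 `windingSum_lt_card_mul`, `neg_card_mul_lt_windingSum` (`|W(f)| < Nπ/2` on admissible flows),
  ★ **`loadedRing_census_le`** (`𝒩 ≤ 2⌊n/4⌋ + 1 = 2⌈N/4⌉ − 1`, sharper by one than the printed
  bound when `4 ∣ N`), `loadedRing_census_le_printed` (the printed `𝒩 ≤ 2⌊N/4⌋ + 1`),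
  `loadedRing_census_le_one_of_le_four` (Cor. 4: `N ≤ 4 ⇒ 𝒩 ≤ 1`, loaded rings included).
* §2 `sub_le_arcsin_sub_arcsin` («x − y ≤ arcsin(x) − arcsin(y)», the VALID half of the printed
  trigonometric relation), `loadedRing_cycleFlow_range_ge` (`Δf_c ≥ 2K_min − P̄_max`),
  ★ **`loadedRing_census_ge`** — Cor. 3's LOWER bound `𝒩 ≥ ⌈(N/2π)(2K_min − P̄_max)/K_max⌉ − 1`.
* §3 ★ **`loadedRing_two_le_census`** — Cor. 4's multistability criterion:
  `P̄_max < 2K_min − (4π/N)K_max ⇒ 𝒩 ≥ 2` (at least two coexisting normal-operation — hence stable,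
  `loadedRing_normalOperation_census` — synchronous states).
* §4 ★★ **`loadedRing_printed_upper_bound_fails`** — a KERNEL COUNTEREXAMPLE to the printed upper
  bound `𝒩 ≤ ⌈(N/4)(2K_max − P̄_max)/K_min⌉` of Cor. 3: the ring of `N = 24` machines with unit
  capacities, one generator injecting `5/3` and one load drawing `5/3` at antipodal nodes
  (reference flow `±5/6` on the two half-rings) has EXACTLY `𝒩 = 3` pinned normal-operation
  synchronous states (winding numbers `−1, 0, 1`; `ϖ(f_max) = 3 − (6/π)arcsin(2/3) ∈ (1, 2)` since
  `1/2 < 2/3 < √3/2`), whereas the printed bound evaluates to `⌈6·(2 − 5/3)⌉ = 2 < 3`. The flaw in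
  the printed proof is the relation «arcsin(x) − arcsin(y) ≤ (π/2)(x − y) for all −1 ≤ y ≤ x ≤ 1»,
  false near `±1` (e.g. `x = 1`, `y = 0.9`); the other three bounds of Cor. 3 stand (§1–§2).

* §5 (APPENDED) THE CORRECTED UPPER BOUND. `arcsin_sub_arcsin_le_arccos` — the SHARP replacement
  of the refuted relation: `arcsin(x) − arcsin(y) ≤ arccos(1 − (x − y))` for `−1 ≤ y ≤ x ≤ 1`
  (equality at `x = 1` or `y = −1`; algebraically `√(1−x²)√(1−y²) ≥ (1 − x)(1 + y)`);
  `loadedRing_cycleFlow_range_le` (`Δf_c ≤ 2K_max − P̄_max`, printed and valid); ★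
  **`loadedRing_census_le_corrected`**: `𝒩 ≤ ⌈(N/2π)·arccos(1 − (2K_max − P̄_max)/K_min)⌉` — what
  the printed argument yields once the false linear relation is replaced by the sharp one (on the
  24-node instance of §4: `⌈(24/2π)·arccos(2/3)⌉ = 4 ≥ 3`).

DEVIATIONS FROM THE PRINT. (i) `P̄_max` is typed through Lemma 4 as the spread of the reference
flow (equal to the maximal partial net power of Def. 13 by that lemma, which is not re-typed);
(ii) the universal upper bound is proved in the sharper form `2⌈N/4⌉ − 1` and the printed
`2⌊N/4⌋ + 1` derived from it; (iii) §4 REFUTES one of the four printed inequalities — recorded, per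
the Literature rules, as a theorem exhibiting the instance, not as a re-worded fact.

THREE COLUMNS. CERTIFIED for MODEL `M` = damped lossless swing model on a ring with positive
capacities and arbitrary injections (MV-1 class): bounds on the number of normal-operation
synchronous states per period from `N`, `K_min`, `K_max`, `P̄_max` alone, and one explicit 24-node
instance with its exact census. NOT CLAIMED: anything outside normal operation; anything about a
power system.
-/

noncomputable section

open Real Set Filter Topology Metric Finset

namespace Literature.MathematicalPhysics.PowerSystems

namespace ClassicalModel

section Bounds

variable {n : ℕ} (S : LosslessSystem (n + 1) 0) (Kv : Fin (n + 1) → ℝ)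

/-! ### §1. The universal upper bound `𝒩 ≤ 2⌈N/4⌉ − 1 ≤ 2⌊N/4⌋ + 1` -/

/-- On an admissible cycle flow every `arcsin` term is `< π/2`, so `W(f) < N·π/2`
(«arcsin(x) ∈ [−π/2, +π/2] such that ϖ(f^max_c) < N/4» — strict on ADMISSIBLE flows).
[cite: ManikTimmeWitthaut2017, §5.4 proof of Cor. 3 (first part)] -/
theorem windingSum_lt_card_mul (hK : ∀ k, 0 < Kv k) {F₀ : Fin (n + 1) → ℝ} {f : ℝ}
    (hf : ∀ k, |F₀ k + f| < Kv k) :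
    ∑ k, Real.arcsin ((F₀ k + f) / Kv k) < ((n : ℝ) + 1) * (π / 2) := by
  have h : ∑ k, Real.arcsin ((F₀ k + f) / Kv k) < ∑ _k : Fin (n + 1), π / 2 := by
    apply Finset.sum_lt_sum_of_nonempty Finset.univ_nonempty
    intro k _
    apply Real.arcsin_lt_pi_div_two.2
    rw [div_lt_one (hK k)]
    exact (abs_lt.1 (hf k)).2
  rw [Finset.sum_const, Finset.card_univ, Fintype.card_fin, nsmul_eq_mul] at h
  push_cast at h
  exact h

/-- … and `> −N·π/2`. [cite: ManikTimmeWitthaut2017, §5.4 proof of Cor. 3 (first part: «ϖ(f^min_c) > −N/4»)] -/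
theorem neg_card_mul_lt_windingSum (hK : ∀ k, 0 < Kv k) {F₀ : Fin (n + 1) → ℝ} {f : ℝ}
    (hf : ∀ k, |F₀ k + f| < Kv k) :
    -(((n : ℝ) + 1) * (π / 2)) < ∑ k, Real.arcsin ((F₀ k + f) / Kv k) := by
  have h : ∑ _k : Fin (n + 1), -(π / 2) < ∑ k, Real.arcsin ((F₀ k + f) / Kv k) := by
    apply Finset.sum_lt_sum_of_nonempty Finset.univ_nonempty
    intro k _
    apply Real.neg_pi_div_two_lt_arcsin.2
    rw [lt_div_iff₀ (hK k)]
    have := (abs_lt.1 (hf k)).1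
    linarith
  rw [Finset.sum_const, Finset.card_univ, Fintype.card_fin, nsmul_eq_mul] at h
  push_cast at h
  linarith

/-- ★ **Cor. 3, first part (sharp form): a loaded ring of `N = n + 1 ≥ 3` machines has AT MOST
`2⌊n/4⌋ + 1 = 2⌈N/4⌉ − 1` normal-operation synchronous states per period** — every attained
winding number `q` has `|2πq| = |W(f)| < Nπ/2`, i.e. `4|q| < N`.
[cite: ManikTimmeWitthaut2017, §5.4 Cor. 3 («0 ≤ 𝒩 ≤ 2⌊N/4⌋ + 1») and its proof (first part)] -/
theorem loadedRing_census_le (hn : 2 ≤ n) (hK : ∀ k, 0 < Kv k)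
    (hC : ∀ i j, S.C i j = if j = finRotate (n + 1) i then Kv i
      else if i = finRotate (n + 1) j then Kv j else 0)
    {F₀ : Fin (n + 1) → ℝ}
    (hF : ∀ k, S.P k - S.D k * ((∑ j, S.P j) / ∑ j, S.D j)
      = F₀ k - F₀ ((finRotate (n + 1)).symm k)) :
    {θ : Fin (n + 1) → ℝ | θ 0 = 0 ∧ (∀ i, θ i ∈ Set.Ico (-π) π) ∧
        (∀ k, S.P k - S.D k * ((∑ j, S.P j) / ∑ j, S.D j) = S.flow θ k) ∧
        ∀ k, 0 < Real.cos (θ k - θ (finRotate (n + 1) k))}.ncard ≤ 2 * (n / 4) + 1 := by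
  rw [loadedRing_ncard_syncStates_eq S Kv hn hK hC hF]
  have hπ := Real.pi_pos
  have hsub : {q : ℤ | ∃ f : ℝ, (∀ k, |F₀ k + f| < Kv k) ∧
      ∑ k, Real.arcsin ((F₀ k + f) / Kv k) = 2 * π * q}
      ⊆ ↑(Finset.Icc (-((n / 4 : ℕ) : ℤ)) ((n / 4 : ℕ) : ℤ)) := by
    rintro q ⟨f, hadm, hW⟩
    rw [Finset.mem_coe, mem_windingWindow_iff]
    have h1 := windingSum_lt_card_mul Kv hK hadm
    have h2 := neg_card_mul_lt_windingSum Kv hK hadm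
    rw [hW] at h1 h2
    have h3 : 4 * |(q : ℝ)| < (n : ℝ) + 1 := by
      rcases le_or_gt 0 (q : ℝ) with h | h
      · rw [abs_of_nonneg h]; nlinarith
      · rw [abs_of_neg h]; nlinarith
    exact_mod_cast h3
  calc {q : ℤ | ∃ f : ℝ, (∀ k, |F₀ k + f| < Kv k) ∧
        ∑ k, Real.arcsin ((F₀ k + f) / Kv k) = 2 * π * q}.ncard
      ≤ (↑(Finset.Icc (-((n / 4 : ℕ) : ℤ)) ((n / 4 : ℕ) : ℤ)) : Set ℤ).ncard :=
        Set.ncard_le_ncard hsub (Finset.finite_toSet _)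
    _ = 2 * (n / 4) + 1 := by rw [Set.ncard_coe_finset, card_windingWindow]

/-- **Cor. 3, first part AS PRINTED: `𝒩 ≤ 2⌊N/4⌋ + 1`** (`N = n + 1`; from the sharp form, since
`⌊n/4⌋ ≤ ⌊(n+1)/4⌋`). [cite: ManikTimmeWitthaut2017, §5.4 Cor. 3 («0 ≤ 𝒩 ≤ 2⌊N/4⌋ + 1»)] -/
theorem loadedRing_census_le_printed (hn : 2 ≤ n) (hK : ∀ k, 0 < Kv k)
    (hC : ∀ i j, S.C i j = if j = finRotate (n + 1) i then Kv i
      else if i = finRotate (n + 1) j then Kv j else 0)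
    {F₀ : Fin (n + 1) → ℝ}
    (hF : ∀ k, S.P k - S.D k * ((∑ j, S.P j) / ∑ j, S.D j)
      = F₀ k - F₀ ((finRotate (n + 1)).symm k)) :
    {θ : Fin (n + 1) → ℝ | θ 0 = 0 ∧ (∀ i, θ i ∈ Set.Ico (-π) π) ∧
        (∀ k, S.P k - S.D k * ((∑ j, S.P j) / ∑ j, S.D j) = S.flow θ k) ∧
        ∀ k, 0 < Real.cos (θ k - θ (finRotate (n + 1) k))}.ncard ≤ 2 * ((n + 1) / 4) + 1 := by
  have h := loadedRing_census_le S Kv hn hK hC hF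
  have h2 : n / 4 ≤ (n + 1) / 4 := Nat.div_le_div_right (Nat.le_succ n)
  omega

/-- **Cor. 4, first sentence, for LOADED rings too: a ring of `N ≤ 4` machines has at most ONE
normal-operation synchronous state per period** («ring networks R_N with N ≤ 4 do not have
multiple stable fixed points»). [cite: ManikTimmeWitthaut2017, §5.4 Cor. 4] -/
theorem loadedRing_census_le_one_of_le_four (hn : 2 ≤ n) (hn4 : n + 1 ≤ 4) (hK : ∀ k, 0 < Kv k)
    (hC : ∀ i j, S.C i j = if j = finRotate (n + 1) i then Kv i
      else if i = finRotate (n + 1) j then Kv j else 0)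
    {F₀ : Fin (n + 1) → ℝ}
    (hF : ∀ k, S.P k - S.D k * ((∑ j, S.P j) / ∑ j, S.D j)
      = F₀ k - F₀ ((finRotate (n + 1)).symm k)) :
    {θ : Fin (n + 1) → ℝ | θ 0 = 0 ∧ (∀ i, θ i ∈ Set.Ico (-π) π) ∧
        (∀ k, S.P k - S.D k * ((∑ j, S.P j) / ∑ j, S.D j) = S.flow θ k) ∧
        ∀ k, 0 < Real.cos (θ k - θ (finRotate (n + 1) k))}.ncard ≤ 1 := by
  have h := loadedRing_census_le S Kv hn hK hC hF
  have : n / 4 = 0 := by omega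
  omega

/-! ### §2. The lower bound `𝒩 ≥ ⌈(N/2π)(2K_min − P̄_max)/K_max⌉ − 1` -/

/-- **«x − y ≤ arcsin(x) − arcsin(y)» for `−1 ≤ y ≤ x ≤ 1`** (the valid half of the printed
trigonometric relation; `sin` is 1-Lipschitz). [cite: ManikTimmeWitthaut2017, §5.4 proof of Cor. 3 (the trigonometric relation)] -/
theorem sub_le_arcsin_sub_arcsin {x y : ℝ} (hx : x ∈ Set.Icc (-1 : ℝ) 1)
    (hy : y ∈ Set.Icc (-1 : ℝ) 1) (hyx : y ≤ x) :
    x - y ≤ Real.arcsin x - Real.arcsin y := by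
  have h1 := Real.abs_sin_sub_sin_le (Real.arcsin x) (Real.arcsin y)
  rw [Real.sin_arcsin hx.1 hx.2, Real.sin_arcsin hy.1 hy.2] at h1
  have h2 : Real.arcsin y ≤ Real.arcsin x := Real.monotone_arcsin hyx
  rw [abs_of_nonneg (by linarith : 0 ≤ Real.arcsin x - Real.arcsin y)] at h1
  linarith [le_abs_self (x - y)]

/-- **«Δf_c ≥ 2K_min − P̄_max»**: the admissible cycle-flow range
`f_max − f_min = minₖ(Kₖ − F⁰ₖ) − maxₖ(−Kₖ − F⁰ₖ)` is at least `2K_min − (maxₖ F⁰ₖ − minₖ F⁰ₖ)`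
(the spread of the reference flow = the maximal partial net power by Lemma 4).
[cite: ManikTimmeWitthaut2017, §5.4 proof of Cor. 3 (bound on Δf_c) and Lemma 4] -/
theorem loadedRing_cycleFlow_range_ge (F₀ : Fin (n + 1) → ℝ) :
    2 * Finset.univ.inf' Finset.univ_nonempty Kv
        - (Finset.univ.sup' Finset.univ_nonempty F₀ - Finset.univ.inf' Finset.univ_nonempty F₀)
      ≤ Finset.univ.inf' Finset.univ_nonempty (fun k => Kv k - F₀ k)
        - Finset.univ.sup' Finset.univ_nonempty (fun k => -Kv k - F₀ k) := by
  have h1 : Finset.univ.inf' Finset.univ_nonempty Kv - Finset.univ.sup' Finset.univ_nonempty F₀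
      ≤ Finset.univ.inf' Finset.univ_nonempty (fun k => Kv k - F₀ k) := by
    apply Finset.le_inf'
    intro k _
    have := Finset.inf'_le Kv (Finset.mem_univ k)
    have := Finset.le_sup' F₀ (Finset.mem_univ k)
    linarith
  have h2 : Finset.univ.sup' Finset.univ_nonempty (fun k => -Kv k - F₀ k)
      ≤ -Finset.univ.inf' Finset.univ_nonempty Kv - Finset.univ.inf' Finset.univ_nonempty F₀ := by
    apply Finset.sup'_le
    intro k _
    have := Finset.inf'_le Kv (Finset.mem_univ k)
    have := Finset.inf'_le F₀ (Finset.mem_univ k)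
    linarith
  linarith

/-- ★ **Cor. 3, second part — the LOWER bound: `𝒩 ≥ ⌈(N/2π)·(2K_min − P̄_max)/K_max⌉ − 1`**
(`N = n + 1 ≥ 3`, `K_min = minₖ Kₖ`, `K_max = maxₖ Kₖ`, `P̄_max = maxₖ F⁰ₖ − minₖ F⁰ₖ`). PROOF (the
printed one): `𝒩 = ⌈ϖ(f_max)⌉ − ⌊ϖ(f_min)⌋ − 1 ≥ ⌈ϖ(f_max) − ϖ(f_min)⌉ − 1`, and termwise
`arcsin x − arcsin y ≥ x − y` gives `ϖ(f_max) − ϖ(f_min) ≥ (1/2π)Σₖ Δf_c/Kₖ ≥ (N/2π)Δf_c/K_max`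
with `Δf_c ≥ 2K_min − P̄_max` (when this is `≤ 0` the bound is void).
[cite: ManikTimmeWitthaut2017, §5.4 Cor. 3 (second display, right inequality) and its proof] -/
theorem loadedRing_census_ge (hn : 2 ≤ n) (hK : ∀ k, 0 < Kv k)
    (hC : ∀ i j, S.C i j = if j = finRotate (n + 1) i then Kv i
      else if i = finRotate (n + 1) j then Kv j else 0)
    {F₀ : Fin (n + 1) → ℝ}
    (hF : ∀ k, S.P k - S.D k * ((∑ j, S.P j) / ∑ j, S.D j)
      = F₀ k - F₀ ((finRotate (n + 1)).symm k)) :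
    (⌈((n : ℝ) + 1) / (2 * π) * ((2 * Finset.univ.inf' Finset.univ_nonempty Kv
        - (Finset.univ.sup' Finset.univ_nonempty F₀ - Finset.univ.inf' Finset.univ_nonempty F₀))
        / Finset.univ.sup' Finset.univ_nonempty Kv)⌉ - 1 : ℤ)
      ≤ ({θ : Fin (n + 1) → ℝ | θ 0 = 0 ∧ (∀ i, θ i ∈ Set.Ico (-π) π) ∧
          (∀ k, S.P k - S.D k * ((∑ j, S.P j) / ∑ j, S.D j) = S.flow θ k) ∧
          ∀ k, 0 < Real.cos (θ k - θ (finRotate (n + 1) k))}.ncard : ℤ) := by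
  have hπ := Real.pi_pos
  have h2π : (0 : ℝ) < 2 * π := by positivity
  have hN : (0 : ℝ) < (n : ℝ) + 1 := by positivity
  set Kmin := Finset.univ.inf' Finset.univ_nonempty Kv with hKmin
  set Kmax := Finset.univ.sup' Finset.univ_nonempty Kv with hKmax
  set Pbar := Finset.univ.sup' Finset.univ_nonempty F₀
    - Finset.univ.inf' Finset.univ_nonempty F₀ with hPbar
  set fmin := Finset.univ.sup' Finset.univ_nonempty (fun k => -Kv k - F₀ k) with hfmin
  set fmax := Finset.univ.inf' Finset.univ_nonempty (fun k => Kv k - F₀ k) with hfmax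
  have hKmax : 0 < Kmax := lt_of_lt_of_le (hK 0) (Finset.le_sup' Kv (Finset.mem_univ 0))
  have hKle : ∀ k, Kv k ≤ Kmax := fun k => Finset.le_sup' Kv (Finset.mem_univ k)
  -- the void case
  by_cases hpos : 2 * Kmin - Pbar ≤ 0
  · have h1 : ((n : ℝ) + 1) / (2 * π) * ((2 * Kmin - Pbar) / Kmax) ≤ 0 :=
      mul_nonpos_of_nonneg_of_nonpos (div_nonneg hN.le h2π.le) (div_nonpos_of_nonpos_of_nonneg hpos hKmax.le)
    have h2 : ⌈((n : ℝ) + 1) / (2 * π) * ((2 * Kmin - Pbar) / Kmax)⌉ ≤ 0 := Int.ceil_nonpos.2 h1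
    have h3 : (0 : ℤ) ≤ ({θ : Fin (n + 1) → ℝ | θ 0 = 0 ∧ (∀ i, θ i ∈ Set.Ico (-π) π) ∧
          (∀ k, S.P k - S.D k * ((∑ j, S.P j) / ∑ j, S.D j) = S.flow θ k) ∧
          ∀ k, 0 < Real.cos (θ k - θ (finRotate (n + 1) k))}.ncard : ℤ) := by positivity
    linarith
  push Not at hpos
  -- the admissible range is at least `2 K_min − P̄_max > 0`
  have hΔ : 2 * Kmin - Pbar ≤ fmax - fmin := loadedRing_cycleFlow_range_ge Kv F₀
  have hlt : fmin < fmax := by linarith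
  have hmin_le : ∀ k, -Kv k - F₀ k ≤ fmin := fun k =>
    Finset.le_sup' (fun k => -Kv k - F₀ k) (Finset.mem_univ k)
  have hmax_le : ∀ k, fmax ≤ Kv k - F₀ k := fun k =>
    Finset.inf'_le (fun k => Kv k - F₀ k) (Finset.mem_univ k)
  have hIcc : ∀ f, fmin ≤ f → f ≤ fmax → ∀ k, (F₀ k + f) / Kv k ∈ Set.Icc (-1 : ℝ) 1 := by
    intro f h1 h2 k
    have := hmin_le k
    have := hmax_le k
    constructor
    · rw [le_div_iff₀ (hK k)]; linarith
    · rw [div_le_iff₀ (hK k)]; linarith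
  -- termwise `arcsin x − arcsin y ≥ x − y = Δ/Kₖ ≥ Δ/K_max`
  have hterm : ∀ k, (fmax - fmin) / Kmax
      ≤ Real.arcsin ((F₀ k + fmax) / Kv k) - Real.arcsin ((F₀ k + fmin) / Kv k) := by
    intro k
    have h1 := sub_le_arcsin_sub_arcsin (hIcc fmax hlt.le le_rfl k) (hIcc fmin le_rfl hlt.le k)
      ((div_le_div_iff_of_pos_right (hK k)).2 (by linarith))
    have h2 : (F₀ k + fmax) / Kv k - (F₀ k + fmin) / Kv k = (fmax - fmin) / Kv k := by
      field_simp
      ring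
    rw [h2] at h1
    exact le_trans (div_le_div_of_nonneg_left (by linarith) (hK k) (hKle k)) h1
  have hsum : ((n : ℝ) + 1) * ((fmax - fmin) / Kmax)
      ≤ ∑ k, Real.arcsin ((F₀ k + fmax) / Kv k) - ∑ k, Real.arcsin ((F₀ k + fmin) / Kv k) := by
    rw [← Finset.sum_sub_distrib]
    have h := Finset.sum_le_sum fun k (_ : k ∈ Finset.univ) => hterm k
    rw [Finset.sum_const, Finset.card_univ, Fintype.card_fin, nsmul_eq_mul] at h
    push_cast at h
    exact h
  -- the count through the window
  rw [loadedRing_ncard_syncStates_eq S Kv hn hK hC hF, windingIntegers_eq Kv hK F₀,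
    ncard_windingIntegers]
  set a := (∑ k, Real.arcsin ((F₀ k + fmax) / Kv k)) / (2 * π) with ha
  set b := (∑ k, Real.arcsin ((F₀ k + fmin) / Kv k)) / (2 * π) with hb
  have hab : ((n : ℝ) + 1) / (2 * π) * ((2 * Kmin - Pbar) / Kmax) ≤ a - b := by
    rw [ha, hb, ← sub_div, div_mul_eq_mul_div, div_le_div_iff_of_pos_right h2π]
    calc ((n : ℝ) + 1) * ((2 * Kmin - Pbar) / Kmax)
        ≤ ((n : ℝ) + 1) * ((fmax - fmin) / Kmax) := by
          apply mul_le_mul_of_nonneg_left _ hN.le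
          exact div_le_div_of_nonneg_right hΔ hKmax.le
      _ ≤ _ := hsum
  have h1 : ⌈((n : ℝ) + 1) / (2 * π) * ((2 * Kmin - Pbar) / Kmax)⌉ ≤ ⌈a - b⌉ := Int.ceil_mono hab
  have h2 : ⌈a - b⌉ ≤ ⌈a⌉ - ⌊b⌋ := by
    have h := Int.ceil_add_le a (-b)
    rw [Int.ceil_neg, ← sub_eq_add_neg] at h
    linarith
  have h3 : (⌈a⌉ - ⌊b⌋ - 1 : ℤ) ≤ ((⌈a⌉ - ⌊b⌋ - 1).toNat : ℤ) := Int.self_le_toNat _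
  linarith

/-! ### §3. Cor. 4: the multistability criterion -/

/-- ★ **Cor. 4 — MULTISTABILITY CRITERION: `P̄_max < 2K_min − (4π/N)K_max ⇒ 𝒩 ≥ 2`** (then the
lower bound of Cor. 3 exceeds `2`; the hypothesis is satisfiable only for `N ≥ 7`): at least TWO
coexisting normal-operation synchronous states per period, each of them STABLE by
`loadedRing_normalOperation_census`. «Ring network R_N with N ≥ 7 nodes will have multiple stable
fixed points (𝒩 ≥ 2) if P̄_max < 2K_min − (4π/N)K_max.»
[cite: ManikTimmeWitthaut2017, §5.4 Cor. 4] -/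
theorem loadedRing_two_le_census (hn : 2 ≤ n) (hK : ∀ k, 0 < Kv k)
    (hC : ∀ i j, S.C i j = if j = finRotate (n + 1) i then Kv i
      else if i = finRotate (n + 1) j then Kv j else 0)
    {F₀ : Fin (n + 1) → ℝ}
    (hF : ∀ k, S.P k - S.D k * ((∑ j, S.P j) / ∑ j, S.D j)
      = F₀ k - F₀ ((finRotate (n + 1)).symm k))
    (hP : Finset.univ.sup' Finset.univ_nonempty F₀ - Finset.univ.inf' Finset.univ_nonempty F₀
      < 2 * Finset.univ.inf' Finset.univ_nonempty Kv
        - 4 * π / ((n : ℝ) + 1) * Finset.univ.sup' Finset.univ_nonempty Kv) :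
    2 ≤ {θ : Fin (n + 1) → ℝ | θ 0 = 0 ∧ (∀ i, θ i ∈ Set.Ico (-π) π) ∧
          (∀ k, S.P k - S.D k * ((∑ j, S.P j) / ∑ j, S.D j) = S.flow θ k) ∧
          ∀ k, 0 < Real.cos (θ k - θ (finRotate (n + 1) k))}.ncard := by
  have hπ := Real.pi_pos
  have h2π : (0 : ℝ) < 2 * π := by positivity
  have hN : (0 : ℝ) < (n : ℝ) + 1 := by positivity
  have hge := loadedRing_census_ge S Kv hn hK hC hF
  set Kmin := Finset.univ.inf' Finset.univ_nonempty Kv with hKmin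
  set Kmax := Finset.univ.sup' Finset.univ_nonempty Kv with hKmax
  set Pbar := Finset.univ.sup' Finset.univ_nonempty F₀
    - Finset.univ.inf' Finset.univ_nonempty F₀ with hPbar
  have hKmax : 0 < Kmax := lt_of_lt_of_le (hK 0) (Finset.le_sup' Kv (Finset.mem_univ 0))
  -- the lower bound's argument exceeds `2`
  have hc : (2 : ℝ) < ((n : ℝ) + 1) / (2 * π) * ((2 * Kmin - Pbar) / Kmax) := by
    have h1 : 4 * π / ((n : ℝ) + 1) * Kmax < 2 * Kmin - Pbar := by linarith
    have h3 : 4 * π / ((n : ℝ) + 1) < (2 * Kmin - Pbar) / Kmax := by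
      rw [lt_div_iff₀ hKmax]
      exact h1
    have h4 : ((n : ℝ) + 1) / (2 * π) * (4 * π / ((n : ℝ) + 1)) = 2 := by
      field_simp
      ring
    calc (2 : ℝ) = ((n : ℝ) + 1) / (2 * π) * (4 * π / ((n : ℝ) + 1)) := h4.symm
      _ < ((n : ℝ) + 1) / (2 * π) * ((2 * Kmin - Pbar) / Kmax) :=
          mul_lt_mul_of_pos_left h3 (by positivity)
  have hceil : (3 : ℤ) ≤ ⌈((n : ℝ) + 1) / (2 * π) * ((2 * Kmin - Pbar) / Kmax)⌉ := by
    have := Int.lt_ceil.2 (by push_cast; exact hc :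
      ((2 : ℤ) : ℝ) < ((n : ℝ) + 1) / (2 * π) * ((2 * Kmin - Pbar) / Kmax))
    omega
  have h : (2 : ℤ) ≤ ({θ : Fin (n + 1) → ℝ | θ 0 = 0 ∧ (∀ i, θ i ∈ Set.Ico (-π) π) ∧
          (∀ k, S.P k - S.D k * ((∑ j, S.P j) / ∑ j, S.D j) = S.flow θ k) ∧
          ∀ k, 0 < Real.cos (θ k - θ (finRotate (n + 1) k))}.ncard : ℤ) := by
    linarith
  exact_mod_cast h

/-! ### §4. ERRATUM: the printed upper bound `𝒩 ≤ ⌈(N/4)(2K_max − P̄_max)/K_min⌉` fails -/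

/-- `π/6 < arcsin(2/3) < π/3` (since `sin(π/6) = 1/2 < 2/3 < √3/2 = sin(π/3)`). [folklore] -/
private theorem arcsin_two_thirds_bounds :
    π / 6 < Real.arcsin (2 / 3) ∧ Real.arcsin (2 / 3) < π / 3 := by
  have hπ := Real.pi_pos
  constructor
  · rw [Real.lt_arcsin_iff_sin_lt ⟨by linarith, by linarith⟩ ⟨by norm_num, by norm_num⟩,
      Real.sin_pi_div_six]
    norm_num
  · rw [Real.arcsin_lt_iff_lt_sin ⟨by norm_num, by norm_num⟩ ⟨by linarith, by linarith⟩,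
      Real.sin_pi_div_three]
    have h : (4 / 3 : ℝ) < Real.sqrt 3 := by
      rw [Real.lt_sqrt (by norm_num)]
      norm_num
    linarith

/-- ★★ **ERRATUM TO COR. 3 — the printed upper bound `⌈(N/4)(2K_max − P̄_max)/K_min⌉ ≥ 𝒩` is
FALSE.** Kernel counterexample: the ring of `N = 24` machines with unit capacities on every edge,
one generator injecting `5/3` (node `0`) and one load drawing `5/3` (node `12`), unit inertias and
dampings; reference flow `F⁰ₖ = +5/6` on the edges `k = 0,…,11` and `−5/6` on `k = 12,…,23`
(`P̄_max = maxₖ F⁰ₖ − minₖ F⁰ₖ = 5/3`, `K_max = K_min = 1`). By Thm 12 (`loadedRing_census`) the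
pinned normal-operation synchronous states number `⌈ϖ(1/6)⌉ − ⌊ϖ(−1/6)⌋ − 1` with
`ϖ(1/6) = (12·π/2 − 12·arcsin(2/3))/2π = 3 − (6/π)arcsin(2/3) ∈ (1, 2)` and `ϖ(−1/6) = −ϖ(1/6)`,
hence EXACTLY `𝒩 = 3` (winding numbers `−1, 0, 1`), whereas the printed bound is
`⌈(24/4)·(2·1 − 5/3)/1⌉ = ⌈2⌉ = 2 < 3`. The printed proof's relation
«arcsin(x) − arcsin(y) ≤ (π/2)(x − y) for all −1 ≤ y ≤ x ≤ 1» fails near `±1`; the lower bound and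
the universal bound `𝒩 ≤ 2⌊N/4⌋ + 1` are unaffected (§1–§2).
[cite: ManikTimmeWitthaut2017, §5.4 Cor. 3 (second display, LEFT inequality «⌈(N/4)(2K_max − P̄_max)/K_min⌉ ≥ 𝒩» — refuted here on an instance; arXiv:1611.09825 TeX as held)] -/
theorem loadedRing_printed_upper_bound_fails :
    ∃ (S : LosslessSystem (23 + 1) 0) (Kv F₀ : Fin (23 + 1) → ℝ),
      (∀ k, 0 < Kv k) ∧
      (∀ i j, S.C i j = if j = finRotate (23 + 1) i then Kv i
        else if i = finRotate (23 + 1) j then Kv j else 0) ∧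
      (∀ k, S.P k - S.D k * ((∑ j, S.P j) / ∑ j, S.D j)
        = F₀ k - F₀ ((finRotate (23 + 1)).symm k)) ∧
      (∀ i, 0 < S.M i) ∧ (∀ i, 0 < S.D i) ∧
      {θ : Fin (23 + 1) → ℝ | θ 0 = 0 ∧ (∀ i, θ i ∈ Set.Ico (-π) π) ∧
          (∀ k, S.P k - S.D k * ((∑ j, S.P j) / ∑ j, S.D j) = S.flow θ k) ∧
          ∀ k, 0 < Real.cos (θ k - θ (finRotate (23 + 1) k))}.ncard = 3 ∧
      ⌈((23 : ℝ) + 1) / 4 * ((2 * Finset.univ.sup' Finset.univ_nonempty Kv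
          - (Finset.univ.sup' Finset.univ_nonempty F₀ - Finset.univ.inf' Finset.univ_nonempty F₀))
          / Finset.univ.inf' Finset.univ_nonempty Kv)⌉ = 2 := by
  have hπ := Real.pi_pos
  have h2π : (0 : ℝ) < 2 * π := by positivity
  -- the instance
  set F₀ : Fin (23 + 1) → ℝ := fun k => if k.val < 12 then 5 / 6 else -(5 / 6) with hF₀
  set Kv : Fin (23 + 1) → ℝ := fun _ => 1 with hKv
  set S : LosslessSystem (23 + 1) 0 :=
    { M := fun _ => 1
      D := fun _ => 1
      P := fun k => F₀ k - F₀ ((finRotate (23 + 1)).symm k)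
      C := fun i j => if j = finRotate (23 + 1) i then Kv i
        else if i = finRotate (23 + 1) j then Kv j else 0
      K := fun _ b => b.elim0
      β := fun b => b.elim0 } with hS
  have hK : ∀ k, 0 < Kv k := fun k => by simp [hKv]
  have hC : ∀ i j, S.C i j = if j = finRotate (23 + 1) i then Kv i
      else if i = finRotate (23 + 1) j then Kv j else 0 := fun i j => rfl
  -- zero net injection, so `ω_s = 0` and `P̃ = P`
  have hsumP : ∑ j, S.P j = 0 := by
    show ∑ j, (F₀ j - F₀ ((finRotate (23 + 1)).symm j)) = 0
    rw [Finset.sum_sub_distrib, Equiv.sum_comp (finRotate (23 + 1)).symm F₀, sub_self]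
  have hF : ∀ k, S.P k - S.D k * ((∑ j, S.P j) / ∑ j, S.D j)
      = F₀ k - F₀ ((finRotate (23 + 1)).symm k) := by
    intro k
    rw [hsumP, zero_div, mul_zero, sub_zero]
  refine ⟨S, Kv, F₀, hK, hC, hF, fun _ => one_pos, fun _ => one_pos, ?_, ?_⟩
  · -- the census by Theorem 12
    rw [loadedRing_census S Kv (by norm_num) hK hC hF]
    -- the admissible range: `f_max = 1/6`, `f_min = −1/6`
    have hfmax : Finset.univ.inf' Finset.univ_nonempty (fun k => Kv k - F₀ k) = 1 / 6 := by
      apply le_antisymm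
      · have h := Finset.inf'_le (fun k => Kv k - F₀ k) (Finset.mem_univ (0 : Fin (23 + 1)))
        have e : Kv 0 - F₀ 0 = 1 / 6 := by simp [hKv, hF₀]; norm_num
        rw [e] at h
        exact h
      · apply Finset.le_inf'
        intro k _
        simp only [hKv, hF₀]
        split_ifs <;> norm_num
    have hfmin : Finset.univ.sup' Finset.univ_nonempty (fun k => -Kv k - F₀ k) = -(1 / 6) := by
      apply le_antisymm
      · apply Finset.sup'_le
        intro k _
        simp only [hKv, hF₀]
        split_ifs <;> norm_num
      · have h := Finset.le_sup' (fun k => -Kv k - F₀ k)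
          (Finset.mem_univ (⟨12, by norm_num⟩ : Fin (23 + 1)))
        have e : -Kv ⟨12, by norm_num⟩ - F₀ ⟨12, by norm_num⟩ = -(1 / 6) := by
          simp [hKv, hF₀]; norm_num
        rw [e] at h
        exact h
    rw [hfmax, hfmin]
    -- the two winding sums
    have hcard : (Finset.univ.filter (fun k : Fin (23 + 1) => k.val < 12)).card = 12 := by decide
    have hcard' : (Finset.univ.filter (fun k : Fin (23 + 1) => ¬ k.val < 12)).card = 12 := by
      decide
    have hWmax : ∑ k : Fin (23 + 1), Real.arcsin ((F₀ k + 1 / 6) / Kv k)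
        = 12 * (π / 2) + 12 * -Real.arcsin (2 / 3) := by
      have hpt : ∀ k : Fin (23 + 1), Real.arcsin ((F₀ k + 1 / 6) / Kv k)
          = if k.val < 12 then π / 2 else -Real.arcsin (2 / 3) := by
        intro k
        simp only [hF₀, hKv, div_one]
        split_ifs
        · norm_num
        · rw [show (-(5 / 6) + 1 / 6 : ℝ) = -(2 / 3) by norm_num, Real.arcsin_neg]
      rw [Finset.sum_congr rfl fun k _ => hpt k, Finset.sum_ite, Finset.sum_const,
        Finset.sum_const, hcard, hcard', nsmul_eq_mul, nsmul_eq_mul]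
      push_cast
      ring
    have hWmin : ∑ k : Fin (23 + 1), Real.arcsin ((F₀ k + -(1 / 6)) / Kv k)
        = 12 * Real.arcsin (2 / 3) + 12 * -(π / 2) := by
      have hpt : ∀ k : Fin (23 + 1), Real.arcsin ((F₀ k + -(1 / 6)) / Kv k)
          = if k.val < 12 then Real.arcsin (2 / 3) else -(π / 2) := by
        intro k
        simp only [hF₀, hKv, div_one]
        split_ifs
        · norm_num
        · rw [show (-(5 / 6) + -(1 / 6) : ℝ) = -1 by norm_num, Real.arcsin_neg, Real.arcsin_one]
      rw [Finset.sum_congr rfl fun k _ => hpt k, Finset.sum_ite, Finset.sum_const,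
        Finset.sum_const, hcard, hcard', nsmul_eq_mul, nsmul_eq_mul]
      push_cast
      ring
    rw [hWmax, hWmin]
    obtain ⟨hA1, hA2⟩ := arcsin_two_thirds_bounds
    -- `⌈3 − (6/π)A⌉ = 2`, `⌊(6/π)A − 3⌋ = −2`
    have hceil : ⌈(12 * (π / 2) + 12 * -Real.arcsin (2 / 3)) / (2 * π)⌉ = 2 := by
      rw [Int.ceil_eq_iff]
      constructor
      · rw [lt_div_iff₀ h2π]; push_cast; nlinarith
      · rw [div_le_iff₀ h2π]; push_cast; nlinarith
    have hfloor : ⌊(12 * Real.arcsin (2 / 3) + 12 * -(π / 2)) / (2 * π)⌋ = -2 := by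
      rw [Int.floor_eq_iff]
      constructor
      · rw [le_div_iff₀ h2π]; push_cast; nlinarith
      · rw [div_lt_iff₀ h2π]; push_cast; nlinarith
    rw [hceil, hfloor]
    decide
  · -- the printed bound evaluates to `⌈6 · (2 − 5/3)⌉ = 2`
    have hKsup : Finset.univ.sup' Finset.univ_nonempty Kv = 1 := by
      rw [hKv, Finset.sup'_const]
    have hKinf : Finset.univ.inf' Finset.univ_nonempty Kv = 1 := by
      apply le_antisymm
      · exact Finset.inf'_le Kv (Finset.mem_univ (0 : Fin (23 + 1)))
      · exact Finset.le_inf' _ _ fun k _ => le_rfl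
    have hFsup : Finset.univ.sup' Finset.univ_nonempty F₀ = 5 / 6 := by
      apply le_antisymm
      · apply Finset.sup'_le
        intro k _
        simp only [hF₀]
        split_ifs <;> norm_num
      · have h := Finset.le_sup' F₀ (Finset.mem_univ (0 : Fin (23 + 1)))
        have e : F₀ 0 = 5 / 6 := by simp [hF₀]
        rw [e] at h
        exact h
    have hFinf : Finset.univ.inf' Finset.univ_nonempty F₀ = -(5 / 6) := by
      apply le_antisymm
      · have h := Finset.inf'_le F₀ (Finset.mem_univ (⟨12, by norm_num⟩ : Fin (23 + 1)))
        have e : F₀ ⟨12, by norm_num⟩ = -(5 / 6) := by simp [hF₀]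
        rw [e] at h
        exact h
      · apply Finset.le_inf'
        intro k _
        simp only [hF₀]
        split_ifs <;> norm_num
    rw [hKsup, hKinf, hFsup, hFinf, Int.ceil_eq_iff]
    norm_num

/-! ### §5. The CORRECTED upper bound: `𝒩 ≤ ⌈(N/2π)·arccos(1 − (2K_max − P̄_max)/K_min)⌉` -/

/-- **The sharp replacement of the refuted relation: `arcsin(x) − arcsin(y) ≤ arccos(1 − (x − y))`
for `−1 ≤ y ≤ x ≤ 1`** (equality at `x = 1` or `y = −1`: the modulus of continuity of `arcsin` is
attained at the endpoints). PROOF: with `θ = arcsin x − arcsin y ∈ [0, π]`,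
`cos θ = √(1−x²)√(1−y²) + xy ≥ (1 − x)(1 + y) + xy = 1 − (x − y)` because
`(1−x²)(1−y²) − ((1−x)(1+y))² = 2(1−x)(1+y)(x−y) ≥ 0`, and `arccos` is decreasing.
[cite: ManikTimmeWitthaut2017, §5.4 proof of Cor. 3 (the trigonometric relation «arcsin(x) − arcsin(y) ≤ (π/2)(x − y)», false near ±1 — corrected statement, ours)] -/
theorem arcsin_sub_arcsin_le_arccos {x y : ℝ} (hx : x ∈ Set.Icc (-1 : ℝ) 1)
    (hy : y ∈ Set.Icc (-1 : ℝ) 1) (hyx : y ≤ x) :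
    Real.arcsin x - Real.arcsin y ≤ Real.arccos (1 - (x - y)) := by
  obtain ⟨hx1, hx2⟩ := hx
  obtain ⟨hy1, hy2⟩ := hy
  have hθ0 : 0 ≤ Real.arcsin x - Real.arcsin y := by
    have := Real.monotone_arcsin hyx
    linarith
  have hθπ : Real.arcsin x - Real.arcsin y ≤ π := by
    have h1 := Real.arcsin_le_pi_div_two x
    have h2 := Real.neg_pi_div_two_le_arcsin y
    linarith
  have hcos : Real.cos (Real.arcsin x - Real.arcsin y)
      = Real.sqrt (1 - x ^ 2) * Real.sqrt (1 - y ^ 2) + x * y := by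
    rw [Real.cos_sub, Real.cos_arcsin, Real.cos_arcsin, Real.sin_arcsin hx1 hx2,
      Real.sin_arcsin hy1 hy2]
  have hkey : (1 - x) * (1 + y) ≤ Real.sqrt (1 - x ^ 2) * Real.sqrt (1 - y ^ 2) := by
    have hx0 : 0 ≤ 1 - x ^ 2 := by nlinarith
    have hy0 : 0 ≤ 1 - y ^ 2 := by nlinarith
    rw [← Real.sqrt_mul hx0 (1 - y ^ 2),
      Real.le_sqrt (mul_nonneg (by linarith) (by linarith)) (mul_nonneg hx0 hy0)]
    have e : (1 - x ^ 2) * (1 - y ^ 2) - ((1 - x) * (1 + y)) ^ 2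
        = (1 - x) * (1 + y) * (2 * (x - y)) := by ring
    have hp : 0 ≤ (1 - x) * (1 + y) * (2 * (x - y)) :=
      mul_nonneg (mul_nonneg (by linarith) (by linarith)) (by linarith)
    linarith
  have hge : 1 - (x - y) ≤ Real.cos (Real.arcsin x - Real.arcsin y) := by
    rw [hcos]
    nlinarith
  calc Real.arcsin x - Real.arcsin y
      = Real.arccos (Real.cos (Real.arcsin x - Real.arcsin y)) := (Real.arccos_cos hθ0 hθπ).symm
    _ ≤ Real.arccos (1 - (x - y)) := Real.arccos_le_arccos hge

/-- **«Δf_c ≤ 2K_max − P̄_max»** (printed and valid): the admissible cycle-flow range is at most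
`2K_max − (maxₖ F⁰ₖ − minₖ F⁰ₖ)`. [cite: ManikTimmeWitthaut2017, §5.4 proof of Cor. 3 («In a similar way we find Δf_c ≤ 2K_max − P̄_max»)] -/
theorem loadedRing_cycleFlow_range_le (F₀ : Fin (n + 1) → ℝ) :
    Finset.univ.inf' Finset.univ_nonempty (fun k => Kv k - F₀ k)
        - Finset.univ.sup' Finset.univ_nonempty (fun k => -Kv k - F₀ k)
      ≤ 2 * Finset.univ.sup' Finset.univ_nonempty Kv
        - (Finset.univ.sup' Finset.univ_nonempty F₀ - Finset.univ.inf' Finset.univ_nonempty F₀) := by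
  obtain ⟨j, _, hj⟩ := Finset.exists_mem_eq_sup' Finset.univ_nonempty F₀
  obtain ⟨i, _, hi⟩ := Finset.exists_mem_eq_inf' Finset.univ_nonempty F₀
  have h1 : Finset.univ.inf' Finset.univ_nonempty (fun k => Kv k - F₀ k) ≤ Kv j - F₀ j :=
    Finset.inf'_le (fun k => Kv k - F₀ k) (Finset.mem_univ j)
  have h2 : -Kv i - F₀ i ≤ Finset.univ.sup' Finset.univ_nonempty (fun k => -Kv k - F₀ k) :=
    Finset.le_sup' (fun k => -Kv k - F₀ k) (Finset.mem_univ i)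
  have h3 : Kv j ≤ Finset.univ.sup' Finset.univ_nonempty Kv := Finset.le_sup' Kv (Finset.mem_univ j)
  have h4 : Kv i ≤ Finset.univ.sup' Finset.univ_nonempty Kv := Finset.le_sup' Kv (Finset.mem_univ i)
  rw [hj, hi]
  linarith

/-- ★ **THE CORRECTED UPPER BOUND OF COR. 3: `𝒩 ≤ ⌈(N/2π)·arccos(1 − (2K_max − P̄_max)/K_min)⌉`**
(`N = n + 1 ≥ 3`, `K_max = maxₖ Kₖ`, `K_min = minₖ Kₖ`, `P̄_max = maxₖ F⁰ₖ − minₖ F⁰ₖ`; `arccos`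
extended by `π` below `−1`, so the bound degrades gracefully to the universal one) — the printed
argument `𝒩 ≤ ⌈ϖ(f_max) − ϖ(f_min)⌉` carried out with the sharp relation
`arcsin x − arcsin y ≤ arccos(1 − (x − y))` in place of the refuted `(π/2)(x − y)`:
`ϖ(f_max) − ϖ(f_min) ≤ (1/2π)Σₖ arccos(1 − Δf_c/Kₖ) ≤ (N/2π)·arccos(1 − Δf_c/K_min)
≤ (N/2π)·arccos(1 − (2K_max − P̄_max)/K_min)`. On the instance of §4: `⌈(24/2π)arccos(2/3)⌉ = 4 ≥ 3`.
[cite: ManikTimmeWitthaut2017, §5.4 Cor. 3 (second display, left inequality — CORRECTED form, ours; the printed `⌈(N/4)(2K_max − P̄_max)/K_min⌉` fails by `loadedRing_printed_upper_bound_fails`)] -/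
theorem loadedRing_census_le_corrected (hn : 2 ≤ n) (hK : ∀ k, 0 < Kv k)
    (hC : ∀ i j, S.C i j = if j = finRotate (n + 1) i then Kv i
      else if i = finRotate (n + 1) j then Kv j else 0)
    {F₀ : Fin (n + 1) → ℝ}
    (hF : ∀ k, S.P k - S.D k * ((∑ j, S.P j) / ∑ j, S.D j)
      = F₀ k - F₀ ((finRotate (n + 1)).symm k)) :
    {θ : Fin (n + 1) → ℝ | θ 0 = 0 ∧ (∀ i, θ i ∈ Set.Ico (-π) π) ∧
        (∀ k, S.P k - S.D k * ((∑ j, S.P j) / ∑ j, S.D j) = S.flow θ k) ∧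
        ∀ k, 0 < Real.cos (θ k - θ (finRotate (n + 1) k))}.ncard
      ≤ ⌈((n : ℝ) + 1) / (2 * π) * Real.arccos (1 - (2 * Finset.univ.sup' Finset.univ_nonempty Kv
          - (Finset.univ.sup' Finset.univ_nonempty F₀ - Finset.univ.inf' Finset.univ_nonempty F₀))
          / Finset.univ.inf' Finset.univ_nonempty Kv)⌉.toNat := by
  have hπ := Real.pi_pos
  have h2π : (0 : ℝ) < 2 * π := by positivity
  have hN : (0 : ℝ) < (n : ℝ) + 1 := by positivity
  have hΔle := loadedRing_cycleFlow_range_le Kv F₀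
  rw [loadedRing_ncard_syncStates_eq S Kv hn hK hC hF, windingIntegers_eq Kv hK F₀,
    ncard_windingIntegers]
  set Kmin := Finset.univ.inf' Finset.univ_nonempty Kv with hKmin
  set Kmax := Finset.univ.sup' Finset.univ_nonempty Kv with hKmax
  set Pbar := Finset.univ.sup' Finset.univ_nonempty F₀
    - Finset.univ.inf' Finset.univ_nonempty F₀ with hPbar
  set fmin := Finset.univ.sup' Finset.univ_nonempty (fun k => -Kv k - F₀ k) with hfmin
  set fmax := Finset.univ.inf' Finset.univ_nonempty (fun k => Kv k - F₀ k) with hfmax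
  set a := (∑ k, Real.arcsin ((F₀ k + fmax) / Kv k)) / (2 * π) with ha
  set b := (∑ k, Real.arcsin ((F₀ k + fmin) / Kv k)) / (2 * π) with hb
  set c := ((n : ℝ) + 1) / (2 * π) * Real.arccos (1 - (2 * Kmax - Pbar) / Kmin) with hc
  have hKmin : 0 < Kmin := (Finset.lt_inf'_iff _).2 fun k _ => hK k
  have hKmin_le : ∀ k, Kmin ≤ Kv k := fun k => Finset.inf'_le Kv (Finset.mem_univ k)
  have hc0 : 0 ≤ c := mul_nonneg (div_nonneg hN.le h2π.le) (Real.arccos_nonneg _)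
  -- integers strictly inside `(b, a)` are at most `⌈a − b⌉`
  have hcount : ⌈a⌉ - ⌊b⌋ - 1 ≤ ⌈a - b⌉ := by
    have h1 := Int.ceil_add_le (a - b) b
    rw [sub_add_cancel] at h1
    have h2 := Int.ceil_le_floor_add_one b
    linarith
  -- `a − b ≤ c`
  have hab : a - b ≤ c := by
    by_cases hle : fmin ≤ fmax
    · have hmin_le : ∀ k, -Kv k - F₀ k ≤ fmin := fun k =>
        Finset.le_sup' (fun k => -Kv k - F₀ k) (Finset.mem_univ k)
      have hmax_le : ∀ k, fmax ≤ Kv k - F₀ k := fun k =>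
        Finset.inf'_le (fun k => Kv k - F₀ k) (Finset.mem_univ k)
      have hIcc : ∀ f, fmin ≤ f → f ≤ fmax → ∀ k, (F₀ k + f) / Kv k ∈ Set.Icc (-1 : ℝ) 1 := by
        intro f h1 h2 k
        have := hmin_le k
        have := hmax_le k
        constructor
        · rw [le_div_iff₀ (hK k)]; linarith
        · rw [div_le_iff₀ (hK k)]; linarith
      have hΔ0 : 0 ≤ fmax - fmin := by linarith
      -- termwise: sharp relation, then monotonicity of `arccos` in the capacity
      have hterm : ∀ k, Real.arcsin ((F₀ k + fmax) / Kv k) - Real.arcsin ((F₀ k + fmin) / Kv k)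
          ≤ Real.arccos (1 - (2 * Kmax - Pbar) / Kmin) := by
        intro k
        have h1 := arcsin_sub_arcsin_le_arccos (hIcc fmax hle le_rfl k) (hIcc fmin le_rfl hle k)
          ((div_le_div_iff_of_pos_right (hK k)).2 (by linarith))
        have h2 : (F₀ k + fmax) / Kv k - (F₀ k + fmin) / Kv k = (fmax - fmin) / Kv k := by
          field_simp
          ring
        rw [h2] at h1
        refine le_trans h1 (Real.arccos_le_arccos ?_)
        have h3 : (fmax - fmin) / Kv k ≤ (fmax - fmin) / Kmin :=
          div_le_div_of_nonneg_left hΔ0 hKmin (hKmin_le k)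
        have h4 : (fmax - fmin) / Kmin ≤ (2 * Kmax - Pbar) / Kmin :=
          div_le_div_of_nonneg_right hΔle hKmin.le
        linarith
      have hsum : ∑ k, Real.arcsin ((F₀ k + fmax) / Kv k) - ∑ k, Real.arcsin ((F₀ k + fmin) / Kv k)
          ≤ ((n : ℝ) + 1) * Real.arccos (1 - (2 * Kmax - Pbar) / Kmin) := by
        rw [← Finset.sum_sub_distrib]
        have h := Finset.sum_le_sum fun k (_ : k ∈ Finset.univ) => hterm k
        rw [Finset.sum_const, Finset.card_univ, Fintype.card_fin, nsmul_eq_mul] at h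
        push_cast at h
        exact h
      rw [ha, hb, hc, ← sub_div, div_le_iff₀ h2π]
      have e : ((n : ℝ) + 1) / (2 * π) * Real.arccos (1 - (2 * Kmax - Pbar) / Kmin) * (2 * π)
          = ((n : ℝ) + 1) * Real.arccos (1 - (2 * Kmax - Pbar) / Kmin) := by
        field_simp
      rw [e]
      exact hsum
    · push Not at hle
      have h1 := windingSum_le Kv hK F₀ hle.le
      have h2 : a ≤ b := by
        rw [ha, hb]
        exact div_le_div_of_nonneg_right h1 h2π.le
      linarith
  have h1 : ⌈a⌉ - ⌊b⌋ - 1 ≤ ⌈c⌉ := le_trans hcount (Int.ceil_mono hab)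
  exact Int.toNat_le_toNat h1

end Bounds

end ClassicalModel

end Literature.MathematicalPhysics.PowerSystems

end
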